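import Mathlib
import Summits.NavierStokesRegularity.NavierStokesRegularity.Theorems.FilamentSkeletonRssKelvinGateWeightedSlices
import Summits.NavierStokesRegularity.NavierStokesRegularity.Theorems.FilamentSkeletonRssKelvinGateFreeResolventC0

/-!
# Route `FilamentSkeletonRss` · crux `TransverseReduction1A` (stmt-27414; successor of the aside `TransverseReductionRJ`,
# stmt-21221) — line `kelvin_gate`: the FREE RESOLVENT ON WEIGHT-`a` HÖLDER DATA (velocity part of the sharp-scale free gate)

Helper file (theorems only, `--as helper`).  HONEST FRAMING: analysis bookkeeping for a HYPOTHETICAL filament-type rotating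
self-similar blow-up route; nothing here bears on Navier–Stokes regularity; no stub is proved here.

Main result (`free_resolvent_weighted`, item m4 of the design memo SHARP-WEIGHTS-DESIGN-21221-g7): for `1 < a < 2` and
`0 < β ≤ 1` there is `C ≥ 0` such that for every rate `α` and every CONTINUOUS `G : ℝ³ → ℝ³` with
`(1+|z|)^a ‖G z‖ ≤ A₀` and the `⟨x⟩^a`-weighted LOCAL `β`-modulus `(1+|x|)^a ‖G z − G x‖ ≤ A₁ |z − x|^β` (`2|z−x| ≤ 1+|x|`),
the free resolvent `W(y) = ∫₀^∞ (e^{-s/2}R_{−αs})(e^{(1−e^{-s})Δ}G)(e^{-s/2}R_{αs}y) ds` is `C²`, solves the free linearised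
profile equation `𝓛_(α,0) W = G` pointwise, and lies in the sharp X-scale of weight `a`:

  `(1+|y|) ‖W(y)‖ ≤ C A₀`,  `(1+|y|)^a ‖DW(y)‖ ≤ C A₀`,  `(1+|y|)^a ‖D²W(y)‖ ≤ C (A₀ + A₁)`,

uniformly in `α`.  Ingredients: the weight-`a` heat toolkit (`weightK_heat_toolkit`), the slice dominations of
`…KelvinGateWeightedSlices`, the transport kernel at exponent `a` (`transport_kernel_rpow`) and the abstract-domination assembly
`…KelvinGateFreeResolventC0`.  With the free pressure step (`…KelvinGateFreePressure` + the projected-datum bounds) this is the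
velocity part of the free Kelvin gate on ALL data of the sharp Y-scale; that composition is the next file.
-/

set_option linter.dupNamespace false

noncomputable section

namespace Summit.NavierStokesRegularity.NavierStokesRegularity.Theorems.KelvinGate

open Set Function Filter Topology InnerProductSpace MeasureTheory Real Metric
open Literature.Analysis.FluidPDE Literature.Analysis.UnboundedOperators
open scoped Laplacian RealInnerProductSpace ContDiff Topology ENNReal

/-- `e^{-bs}(1 + s^{-p})` has a nonnegative integral on `(0, ∞)`. -/
theorem integral_exp_neg_mul_one_add_rpow_neg_nonneg (b p : ℝ) :
    0 ≤ ∫ s in Ioi (0:ℝ), exp (-(b * s)) * (1 + s ^ (-p)) :=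
  setIntegral_nonneg measurableSet_Ioi fun s hs => by
    have : 0 < s := hs
    positivity

/-- **THE FREE RESOLVENT ON WEIGHT-`a` HÖLDER DATA.**  See the module docstring. -/
theorem free_resolvent_weighted {a β : ℝ} (ha1 : 1 < a) (ha2 : a < 2) (hβ0 : 0 < β) (hβ1 : β ≤ 1) :
    ∃ C : ℝ, 0 ≤ C ∧ ∀ (α : ℝ) (G : EuclideanSpace ℝ (Fin 3) → EuclideanSpace ℝ (Fin 3)), Continuous G →
      ∀ (A₀ A₁ : ℝ), 0 ≤ A₁ → (∀ z, (1 + ‖z‖) ^ a * ‖G z‖ ≤ A₀) →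
      (∀ x z, 2 * ‖z - x‖ ≤ 1 + ‖x‖ → (1 + ‖x‖) ^ a * ‖G z - G x‖ ≤ A₁ * ‖z - x‖ ^ β) →
      ContDiff ℝ 2 (fun y => ∫ s in Ioi (0:ℝ), (Real.exp (-(s / 2)) • rotZL (-(α * s)))
          (heatExtension G (1 - Real.exp (-s)) ((Real.exp (-(s / 2)) • rotZL (α * s)) y))) ∧
      (∀ y, (1 + ‖y‖) * ‖∫ s in Ioi (0:ℝ), (Real.exp (-(s / 2)) • rotZL (-(α * s)))
          (heatExtension G (1 - Real.exp (-s)) ((Real.exp (-(s / 2)) • rotZL (α * s)) y))‖ ≤ C * A₀) ∧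
      (∀ y, (1 + ‖y‖) ^ a * ‖fderiv ℝ (fun y => ∫ s in Ioi (0:ℝ), (Real.exp (-(s / 2)) • rotZL (-(α * s)))
          (heatExtension G (1 - Real.exp (-s)) ((Real.exp (-(s / 2)) • rotZL (α * s)) y))) y‖ ≤ C * A₀) ∧
      (∀ y, (1 + ‖y‖) ^ a * ‖fderiv ℝ (fderiv ℝ (fun y => ∫ s in Ioi (0:ℝ), (Real.exp (-(s / 2)) • rotZL (-(α * s)))
          (heatExtension G (1 - Real.exp (-s)) ((Real.exp (-(s / 2)) • rotZL (α * s)) y)))) y‖ ≤ C * (A₀ + A₁)) ∧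
      (∀ y, lerayLin α (fun _ => 0) (fun y => ∫ s in Ioi (0:ℝ), (Real.exp (-(s / 2)) • rotZL (-(α * s)))
          (heatExtension G (1 - Real.exp (-s)) ((Real.exp (-(s / 2)) • rotZL (α * s)) y))) y = G y) := by
  have ha0 : 0 ≤ a := by linarith
  obtain ⟨C_T, hCT0, hT⟩ := weightK_heat_toolkit (E := EuclideanSpace ℝ (Fin 3)) (F := EuclideanSpace ℝ (Fin 3))
    (k := a) (β := β) ha1.le ha2.le hβ0.le hβ1
  -- the four absolute integrals
  set K₀ : ℝ := 2 * a / (a - 1) with hK₀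
  have hK₀0 : 0 ≤ K₀ := by rw [hK₀]; exact div_nonneg (by linarith) (by linarith)
  set I₁ : ℝ := ∫ s in Ioi (0:ℝ), exp (-((2 - a) / 2 * s)) * (1 + s ^ (-(1 / 2 : ℝ))) with hI₁
  set I₂ : ℝ := ∫ s in Ioi (0:ℝ), exp (-((3 - a) / 2 * s)) * (1 + s ^ (-(1 - β / 2))) with hI₂
  set I₃ : ℝ := ∫ s in Ioi (0:ℝ), exp (-((3 - a) / 2 * s)) * (1 + s ^ (-(1 / 2 : ℝ))) with hI₃
  have hI₁0 : 0 ≤ I₁ := integral_exp_neg_mul_one_add_rpow_neg_nonneg _ _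
  have hI₂0 : 0 ≤ I₂ := integral_exp_neg_mul_one_add_rpow_neg_nonneg _ _
  have hI₃0 : 0 ≤ I₃ := integral_exp_neg_mul_one_add_rpow_neg_nonneg _ _
  have hI₁i : IntegrableOn (fun s : ℝ => exp (-((2 - a) / 2 * s)) * (1 + s ^ (-(1 / 2 : ℝ)))) (Ioi 0) :=
    integrableOn_exp_neg_mul_one_add_rpow_neg (by linarith) (by norm_num)
  have hI₂i : IntegrableOn (fun s : ℝ => exp (-((3 - a) / 2 * s)) * (1 + s ^ (-(1 - β / 2)))) (Ioi 0) :=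
    integrableOn_exp_neg_mul_one_add_rpow_neg (by linarith) (by linarith)
  have hI₃i : IntegrableOn (fun s : ℝ => exp (-((3 - a) / 2 * s)) * (1 + s ^ (-(1 / 2 : ℝ)))) (Ioi 0) :=
    integrableOn_exp_neg_mul_one_add_rpow_neg (by linarith) (by norm_num)
  refine ⟨C_T * (K₀ + I₁ + I₂ + I₃), by positivity, ?_⟩
  intro α G hG A₀ A₁ hA₁ h0 h1
  obtain ⟨hC, hA₀⟩ := norm_le_and_nonneg_of_rpow_weight ha0 h0
  -- the toolkit on `G`
  have hV : ∀ ⦃t : ℝ⦄, 0 < t → t ≤ 1 → ∀ x, (1 + ‖x‖) ^ a * ‖heatExtension G t x‖ ≤ C_T * A₀ :=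
    fun t ht ht1 => (hT G hG A₀ h0 ht ht1).1
  have hGr : ∀ ⦃t : ℝ⦄, 0 < t → t ≤ 1 → ∀ x, (1 + ‖x‖) ^ a * ‖fderiv ℝ (heatExtension G t) x‖ ≤
      C_T * t ^ (-(1 / 2 : ℝ)) * A₀ := fun t ht ht1 => (hT G hG A₀ h0 ht ht1).2.1
  have hHe : ∀ ⦃t : ℝ⦄, 0 < t → t ≤ 1 → ∀ x, (1 + ‖x‖) ^ a * ‖fderiv ℝ (fderiv ℝ (heatExtension G t)) x‖ ≤
      C_T * (t ^ (-(1:ℝ) + β / 2) * A₁ + t ^ (-(1 / 2 : ℝ)) * A₀) := fun t ht ht1 => (hT G hG A₀ h0 ht ht1).2.2 A₁ hA₁ h1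
  -- the dominations `b₁`, `b₂`
  have hb₁ : IntegrableOn (fun s : ℝ => C_T * A₀ * (exp (-s) * (1 + s ^ (-(1 / 2 : ℝ))))) (Ioi 0) := by
    have h := integrableOn_exp_neg_mul_one_add_rpow_neg (b := 1) (p := 1 / 2) one_pos (by norm_num)
    exact (h.congr_fun (fun s _ => by rw [one_mul]) measurableSet_Ioi).const_mul _
  have hD1 := fun s (hs : 0 < s) y => norm_fderiv_freeSlice_le_uniform ha0 hG h0 hGr α hs y
  have hb₂ : IntegrableOn (fun s : ℝ => C_T * (exp (-(3 / 2 * s)) *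
      ((1 + s ^ (-(1 - β / 2))) * A₁ + (1 + s ^ (-(1 / 2 : ℝ))) * A₀))) (Ioi 0) := by
    have h2 := integrableOn_exp_neg_mul_one_add_rpow_neg (b := 3 / 2) (p := 1 - β / 2) (by norm_num) (by linarith)
    have h3 := integrableOn_exp_neg_mul_one_add_rpow_neg (b := 3 / 2) (p := 1 / 2) (by norm_num) (by norm_num)
    exact (IntegrableOn.congr_fun ((h2.mul_const A₁).add (h3.mul_const A₀))
      (fun s _ => by simp only [Pi.add_apply]; ring) measurableSet_Ioi).const_mul _
  have hD2 := fun s (hs : 0 < s) y => norm_fderiv_fderiv_freeSlice_le_uniform ha0 hβ0 hβ1 hA₁ hCT0.le hG h0 hHe α hs y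
  -- derivatives under the integral
  have hD1f : ∀ y, fderiv ℝ (fun y => ∫ s in Ioi (0:ℝ), (Real.exp (-(s / 2)) • rotZL (-(α * s)))
        (heatExtension G (1 - Real.exp (-s)) ((Real.exp (-(s / 2)) • rotZL (α * s)) y))) y =
      ∫ s in Ioi (0:ℝ), fderiv ℝ (fun z => (Real.exp (-(s / 2)) • rotZL (-(α * s)))
        (heatExtension G (1 - Real.exp (-s)) ((Real.exp (-(s / 2)) • rotZL (α * s)) z))) y :=
    fun y => (hasFDerivAt_freeResolvent_of_dominated hG hC hb₁ hD1 y).fderiv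
  have hD2f : ∀ y, fderiv ℝ (fderiv ℝ (fun y => ∫ s in Ioi (0:ℝ), (Real.exp (-(s / 2)) • rotZL (-(α * s)))
        (heatExtension G (1 - Real.exp (-s)) ((Real.exp (-(s / 2)) • rotZL (α * s)) y)))) y =
      ∫ s in Ioi (0:ℝ), fderiv ℝ (fun z => fderiv ℝ (fun z => (Real.exp (-(s / 2)) • rotZL (-(α * s)))
        (heatExtension G (1 - Real.exp (-s)) ((Real.exp (-(s / 2)) • rotZL (α * s)) z))) z) y := by
    intro y
    rw [funext hD1f]
    exact (hasFDerivAt_fderiv_freeResolvent_of_dominated hG hC hb₁ hD1 hb₂ hD2 y).fderiv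
  have hc1 : C_T * K₀ ≤ C_T * (K₀ + I₁ + I₂ + I₃) := by nlinarith
  have hc2 : C_T * I₁ ≤ C_T * (K₀ + I₁ + I₂ + I₃) := by nlinarith
  refine ⟨contDiff_two_freeResolvent_of_dominated hG hC hb₁ hD1 hb₂ hD2, fun y => ?_, fun y => ?_, fun y => ?_,
    fun y => lerayLin_freeResolvent_eq_of_dominated hG hC hb₁ hD1 hb₂ hD2 y⟩
  · -- value: transport kernel at exponent `a`
    obtain ⟨hKi, hKle⟩ := transport_kernel_rpow ha1 (norm_nonneg y)
    have h1 : ‖∫ s in Ioi (0:ℝ), (Real.exp (-(s / 2)) • rotZL (-(α * s)))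
        (heatExtension G (1 - Real.exp (-s)) ((Real.exp (-(s / 2)) • rotZL (α * s)) y))‖ ≤
        ∫ s in Ioi (0:ℝ), C_T * A₀ * (exp (-(s / 2)) * (1 + exp (-(s / 2)) * ‖y‖) ^ (-a)) := by
      refine norm_integral_le_of_norm_le (hKi.const_mul _) ?_
      exact (ae_restrict_iff' measurableSet_Ioi).2
        (Eventually.of_forall fun s hs => norm_freeSlice_le_rpow_kernel hV α hs y)
    rw [integral_const_mul] at h1
    have hy : 0 < 1 + ‖y‖ := by positivity
    calc (1 + ‖y‖) * ‖∫ s in Ioi (0:ℝ), (Real.exp (-(s / 2)) • rotZL (-(α * s)))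
          (heatExtension G (1 - Real.exp (-s)) ((Real.exp (-(s / 2)) • rotZL (α * s)) y))‖
        ≤ (1 + ‖y‖) * (C_T * A₀ * (K₀ / (1 + ‖y‖))) :=
          mul_le_mul_of_nonneg_left (h1.trans (mul_le_mul_of_nonneg_left hKle (by positivity))) hy.le
      _ = C_T * K₀ * A₀ := by field_simp
      _ ≤ C_T * (K₀ + I₁ + I₂ + I₃) * A₀ := mul_le_mul_of_nonneg_right hc1 hA₀
  · -- first derivative, weight `a`
    rw [hD1f]
    have hya : 0 < (1 + ‖y‖) ^ a := by positivity
    have h1 : ‖∫ s in Ioi (0:ℝ), fderiv ℝ (fun z => (Real.exp (-(s / 2)) • rotZL (-(α * s)))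
        (heatExtension G (1 - Real.exp (-s)) ((Real.exp (-(s / 2)) • rotZL (α * s)) z))) y‖ ≤
        ∫ s in Ioi (0:ℝ), (C_T * A₀ / (1 + ‖y‖) ^ a) * (exp (-((2 - a) / 2 * s)) * (1 + s ^ (-(1 / 2 : ℝ)))) := by
      refine norm_integral_le_of_norm_le (hI₁i.const_mul _) ?_
      refine (ae_restrict_iff' measurableSet_Ioi).2 (Eventually.of_forall fun s hs => ?_)
      have h := rpow_weight_norm_fderiv_freeSlice_le ha0 hG h0 hGr α hs y
      rw [div_mul_eq_mul_div, le_div_iff₀ hya, mul_comm]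
      exact h
    rw [integral_const_mul] at h1
    calc (1 + ‖y‖) ^ a * ‖∫ s in Ioi (0:ℝ), fderiv ℝ (fun z => (Real.exp (-(s / 2)) • rotZL (-(α * s)))
          (heatExtension G (1 - Real.exp (-s)) ((Real.exp (-(s / 2)) • rotZL (α * s)) z))) y‖
        ≤ (1 + ‖y‖) ^ a * (C_T * A₀ / (1 + ‖y‖) ^ a * I₁) := mul_le_mul_of_nonneg_left h1 hya.le
      _ = C_T * I₁ * A₀ := by field_simp
      _ ≤ C_T * (K₀ + I₁ + I₂ + I₃) * A₀ := mul_le_mul_of_nonneg_right hc2 hA₀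
  · -- second derivative, weight `a`
    rw [hD2f]
    have hya : 0 < (1 + ‖y‖) ^ a := by positivity
    have hI23 : IntegrableOn (fun s : ℝ => exp (-((3 - a) / 2 * s)) *
        ((1 + s ^ (-(1 - β / 2))) * A₁ + (1 + s ^ (-(1 / 2 : ℝ))) * A₀)) (Ioi 0) :=
      IntegrableOn.congr_fun ((hI₂i.mul_const A₁).add (hI₃i.mul_const A₀))
        (fun s _ => by simp only [Pi.add_apply]; ring) measurableSet_Ioi
    have h1 : ‖∫ s in Ioi (0:ℝ), fderiv ℝ (fun z => fderiv ℝ (fun z => (Real.exp (-(s / 2)) • rotZL (-(α * s)))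
        (heatExtension G (1 - Real.exp (-s)) ((Real.exp (-(s / 2)) • rotZL (α * s)) z))) z) y‖ ≤
        ∫ s in Ioi (0:ℝ), (C_T / (1 + ‖y‖) ^ a) * (exp (-((3 - a) / 2 * s)) *
          ((1 + s ^ (-(1 - β / 2))) * A₁ + (1 + s ^ (-(1 / 2 : ℝ))) * A₀)) := by
      refine norm_integral_le_of_norm_le (hI23.const_mul _) ?_
      refine (ae_restrict_iff' measurableSet_Ioi).2 (Eventually.of_forall fun s hs => ?_)
      have h := rpow_weight_norm_fderiv_fderiv_freeSlice_le ha0 hβ0 hβ1 hA₁ hCT0.le hG h0 hHe α hs y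
      rw [div_mul_eq_mul_div, le_div_iff₀ hya, mul_comm]
      exact h
    have hsplit : ∫ s in Ioi (0:ℝ), exp (-((3 - a) / 2 * s)) *
        ((1 + s ^ (-(1 - β / 2))) * A₁ + (1 + s ^ (-(1 / 2 : ℝ))) * A₀) = I₂ * A₁ + I₃ * A₀ := by
      have e : (fun s : ℝ => exp (-((3 - a) / 2 * s)) * ((1 + s ^ (-(1 - β / 2))) * A₁ + (1 + s ^ (-(1 / 2 : ℝ))) * A₀)) =
          fun s => exp (-((3 - a) / 2 * s)) * (1 + s ^ (-(1 - β / 2))) * A₁ +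
            exp (-((3 - a) / 2 * s)) * (1 + s ^ (-(1 / 2 : ℝ))) * A₀ := by
        funext s; ring
      rw [e, integral_add (hI₂i.mul_const A₁) (hI₃i.mul_const A₀), integral_mul_const, integral_mul_const]
    rw [integral_const_mul, hsplit] at h1
    have hc3 : C_T * (I₂ * A₁ + I₃ * A₀) ≤ C_T * (K₀ + I₁ + I₂ + I₃) * (A₀ + A₁) := by
      have h2 : I₂ * A₁ ≤ (K₀ + I₁ + I₂ + I₃) * A₁ := by nlinarith
      have h3 : I₃ * A₀ ≤ (K₀ + I₁ + I₂ + I₃) * A₀ := by nlinarith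
      nlinarith
    calc (1 + ‖y‖) ^ a * ‖∫ s in Ioi (0:ℝ), fderiv ℝ (fun z => fderiv ℝ (fun z => (Real.exp (-(s / 2)) • rotZL (-(α * s)))
          (heatExtension G (1 - Real.exp (-s)) ((Real.exp (-(s / 2)) • rotZL (α * s)) z))) z) y‖
        ≤ (1 + ‖y‖) ^ a * (C_T / (1 + ‖y‖) ^ a * (I₂ * A₁ + I₃ * A₀)) := mul_le_mul_of_nonneg_left h1 hya.le
      _ = C_T * (I₂ * A₁ + I₃ * A₀) := by field_simp
      _ ≤ C_T * (K₀ + I₁ + I₂ + I₃) * (A₀ + A₁) := hc3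

end Summit.NavierStokesRegularity.NavierStokesRegularity.Theorems.KelvinGate

end
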